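import Summits.ValiantsHypothesis.ValiantsHypothesis.Theorems.NewtonUnitEquationsTwoProductsPermutationTypeCount
import Summits.ValiantsHypothesis.ValiantsHypothesis.Theorems.NewtonUnitEquationsTwoProductsPlanarCellBlockMerge

/-!
# Route NewtonUnitEquations — crux `TwoProducts` (stmt-ValiantsHypothesis-5906): the PERMUTATION-TYPE LAW
# (rung R3 of the registered line `Cruxes/TwoProducts/Lines/relation_ladder.lean`, val-idea-8 g2; verbatim its `Lifted` toolkit @47fa98797544)

Helper mode (`--supports stmt-ValiantsHypothesis-5906 --as helper`; turnkey packaged by the ideator seat val-idea-8 g2).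
Setting of `…FormalLogLinearisationDefs` / `…PlanarCrossCount`: constant-free tails `u, v : Fin m → ℂ[x,y]`, tail alphabet
`T = tailSupport u v`, valid weights `ξ` (`wt ξ e < 0` on `T`), visible points = strict `ξ`-tops of `supp (tailDiff u v)`.
**`visibleCount_of_isBm`**: if `T` is a `B_m`-SET (`IsBm m T`: multisets of `≤ m` letters are determined by their sums — every
additive coincidence between letter tuples is of PERMUTATION TYPE), then GLOBALLY `#visible ≤ 2^{13m}(#T+2)^2`.
Proof (all here): (A) the Wronskian-congruence log-linearisation chain of `…TwoProductsPowerSumCriterion`, re-proved over an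
ARBITRARY finite variable type with REAL additive weights `ω ≥ 1` on nonzero exponents (`strictMin_sub_iff_of_congr`), with the
real Euler derivation (`coeff_eulerDerivation`); (C) for linear forms `U_j = Σ_e c_{je} Y_e` the truncated `Σ log(1+U_j) − Σ log(1+V_j)`
has coefficient `(−1)^{k+1}/k · multinomial(κ) · (Σ_j c_j^κ − Σ_j d_j^κ)` at `κ` (`coeff_logTrunc`), so a strict `θ`-minimum of the
lifted support of `∏(1+U_j) − ∏(1+V_j)` is the strict `θ`-minimal UNEQUAL MOMENT (`lifted_minUnequal`); (D) the push-forward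
`Y_e ↦ X^e` maps the lifted difference to `tailDiff u v` (`phi_liftG`) and is injective on exponents of degree `≤ m` under `IsBm`
(`injDeg_of_isBm`), so a planar visible point lifts to a strict extremum (`minUnequal_of_visible`); (E) weights normalised by
`wt ζ e₀ = −1` form one affine pencil (`pencil_param`); (F) the landed `liftedPencilCount_bound` / `liftedPencilCount_arith`.
(G) FAMILY-LEVEL version `visibleCount_of_permType` (rung R3♯): the same bound under the position-aware hypothesis that every
coincidence of the letter family is of permutation type (`PermType`), via `injOn_of_permType` (a lifted support point of
`∏(1+U_j)` is the letter multiset of a tuple of the family) and `count_of_injOn`; it contains p603804's dissociated regime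
(`permType_of_injOn`) as a GLOBAL bound.
(R5) MERGED version `visibleCount_of_mergedPermType`: contract a block `J ∋ j₀` with sumset `≤ M` (`merge`/`mergeA`, landed
`…PlanarCellBlockMerge`); permutation type of the merged family suffices — contains (G) and the confined-block regime of
`planarCell_blockLaw` (`visibleCount_of_confined_blockSmall`).
Honest framing: a rung of a crux line (the permutation-type case of the lifted → planar step); the line's residual
(`ResidualLawV6`: genuine multiset relations with large blocks), `PlanarCellBound`, the crux `TwoProducts` and `VP ≠ VNP` are
OPEN and NOT claimed.  No instances, no notation, no named literature facts. [folklore]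

PORT NOTE.  Theorems-side port (val-lit port pool, seat val-port-2; crit-3 RE-READ #15/#17: R3/R3♯ PASS by name; director-valiant
g12-R137 (b)) of the ideator's turnkey v3 `turnkey/NewtonUnitEquationsTwoProductsPermutationTypeLaw.lean` sha16 b74751413dcd7320 /
2edb92ad83a38af2 (1410 l., docstring-only delta) = tree `Cruxes/TwoProducts/Lines/relation_ladder_turnkey_PermutationTypeLaw.lean` @237e39b34ac9 / @49d6475e5c64, split by the 400-line
rule into FIVE files, texts VERBATIM, cut at the author's part boundaries: (R3a) `…PermutationTypeWeightOrder.lean` = Parts A/B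
(p611005; v3 l.46–346 = v1 verbatim); (R3b) `…PermutationTypeLifted.lean` = Parts B-end/C/D1 (p611551; v3 l.347–596 = v1 verbatim);
(R3c) `…PermutationTypePushForward.lean` = Parts D2/D3 (v3 l.599–909: `phi`, `piE`, `InjDeg`, the planar instance,
`minUnequal_of_visible` in its v2/v3 `Set.InjOn` form); (R3d) `…PermutationTypeCount.lean` = Part D4 + Count (v3 l.912–1125:
`pencil_param`, `count_of_injOn`, `permutationTypeLaw_proof`); (R3e) `…PermutationTypeFamily.lean` = Part G + R5 + statements (v3
l.1127–1406: `PermType`, `msetT`, `IsBm`, `visibleCount_of_isBm`, `visibleCount_of_permType`, `visibleCount_of_mergedPermType`,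
`visibleCount_of_confined_blockSmall`).  Helper mode (`--supports stmt-ValiantsHypothesis-5906 --as helper`); nothing here closes
the line's residual `ResidualLawV10`, `PlanarCellBound`, the crux `TwoProducts` or `VP ≠ VNP`; no summit statement is proved.
-/

noncomputable section

-- Sub = Summit single-conjunct layout: the duplicated namespace component is mandated by the tree.
set_option linter.dupNamespace false

namespace Summit.ValiantsHypothesis.ValiantsHypothesis.Theorems.NewtonUnitEquations.TwoProducts.PermutationType
open scoped BigOperators
open MvPolynomial

variable {σ : Type*} [Fintype σ] [DecidableEq σ]

/-! ## Part G: FAMILY-LEVEL permutation type (R3♯)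

The injectivity of the push-forward on the lifted support follows from the POSITION-AWARE `B_m`-type hypothesis (equivalent to `IsBm m A` on identical supports `A_j = A`, strictly weaker only for heterogeneous supports) that every
additive coincidence of the letter family `A` (two `0`-filled letter tuples with the same sum) is of permutation type (same
multiset of nonzero letters).  This contains dissociated families (p603804), `B_m` alphabets (R3) and block-merged confined
families (R2⁺) as special cases. -/

section SupportProd

omit [Fintype σ] in
/-- Support of a linear form: single letters with nonzero coefficient. [folklore] -/
theorem mem_support_lin [Fintype σ] (c : σ → ℂ) (κ : σ →₀ ℕ) (h : κ ∈ (lin c).support) :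
    ∃ i, c i ≠ 0 ∧ κ = Finsupp.single i 1 := by
  classical
  unfold lin at h
  obtain ⟨i, -, hi⟩ := Finset.mem_biUnion.1 (support_sum h)
  rw [mem_support_iff, coeff_smul, coeff_X, smul_eq_mul] at hi
  by_cases hκ : Finsupp.single i 1 = κ
  · refine ⟨i, ?_, hκ.symm⟩
    rw [if_pos hκ, mul_one] at hi
    exact hi
  · rw [if_neg hκ, mul_zero] at hi
    exact absurd rfl hi

/-- Support of `1 + (linear form)`: zero or a single letter with nonzero coefficient. [folklore] -/
theorem mem_support_one_add_lin (c : σ → ℂ) (κ : σ →₀ ℕ) (h : κ ∈ (1 + lin c).support) :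
    κ = 0 ∨ ∃ i, c i ≠ 0 ∧ κ = Finsupp.single i 1 := by
  classical
  rcases Finset.mem_union.1 (support_add h) with h1 | h2
  · left
    rw [mem_support_iff, coeff_one] at h1
    split_ifs at h1 with h0
    · exact h0.symm
    · exact absurd rfl h1
  · exact Or.inr (mem_support_lin c κ h2)

/-- Support of `∏_{j ∈ s} (1 + U_j)`: sums of one optional letter per position. [folklore] -/
theorem exists_tuple_of_mem_support_prod {m : ℕ} (c : Fin m → σ → ℂ) (s : Finset (Fin m)) :
    ∀ κ ∈ (∏ j ∈ s, (1 + lin (c j))).support, ∃ g : Fin m → (σ →₀ ℕ),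
      (∀ j, g j = 0 ∨ ∃ i, c j i ≠ 0 ∧ g j = Finsupp.single i 1) ∧ (∀ j ∉ s, g j = 0) ∧ ∑ j ∈ s, g j = κ := by
  classical
  induction s using Finset.induction_on with
  | empty =>
    intro κ hκ
    rw [Finset.prod_empty, mem_support_iff, coeff_one] at hκ
    split_ifs at hκ with h0
    · exact ⟨fun _ => 0, fun j => Or.inl rfl, fun j _ => rfl, by simp [← h0]⟩
    · exact absurd rfl hκ
  | insert a s ha ih =>
    intro κ hκ
    rw [Finset.prod_insert ha] at hκ
    obtain ⟨κ₁, hκ₁, κ₂, hκ₂, rfl⟩ := Finset.mem_add.1 (support_mul _ _ hκ)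
    obtain ⟨g, hg, hgs, hsum⟩ := ih κ₂ hκ₂
    refine ⟨Function.update g a κ₁, ?_, ?_, ?_⟩
    · intro j
      by_cases hj : j = a
      · subst hj
        rw [Function.update_self]
        exact mem_support_one_add_lin (c j) κ₁ hκ₁
      · rw [Function.update_of_ne hj]
        exact hg j
    · intro j hj
      rw [Finset.mem_insert, not_or] at hj
      rw [Function.update_of_ne hj.1]
      exact hgs j hj.2
    · rw [Finset.sum_insert ha, Function.update_self, ← hsum]
      congr 1
      refine Finset.sum_congr rfl fun j hj => ?_
      have hja : j ≠ a := by
        rintro rfl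
        exact ha hj
      rw [Function.update_of_ne hja]

end SupportProd

section PermType
open Summit.ValiantsHypothesis.ValiantsHypothesis.Theorems.NewtonUnitEquations.TwoProducts.FormalLogLinearisation
open Summit.ValiantsHypothesis.ValiantsHypothesis.Theorems.NewtonUnitEquations.TwoProducts.PlanarCell

variable {m : ℕ}

/-- The LETTER MULTISET of a `0`-filled letter tuple (the zeros forgotten). [folklore] -/
def msetT (a : Fin m → Expo) : Expo →₀ ℕ := ∑ j, if a j = 0 then 0 else Finsupp.single (a j) 1

/-- All coincidences of the letter family `A` are of PERMUTATION TYPE: equal sums ⇒ equal letter multisets. [folklore] -/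
def PermType (A : Fin m → Finset Expo) : Prop :=
  ∀ a ∈ tuples A, ∀ b ∈ tuples A, ∑ j, a j = ∑ j, b j → msetT a = msetT b

variable (u v : Fin m → MvPolynomial (Fin 2) ℂ)

/-- `piE_eq_linearCombination` (R3 toolkit). [folklore] -/
theorem piE_eq_linearCombination {s : ℕ} (E : Fin s → Expo) (κ : Fin s →₀ ℕ) :
    piE E κ = Finsupp.linearCombination ℕ E κ := (Finsupp.linearCombination_apply ℕ κ).symm

/-- `piE_single'` (R3 toolkit). [folklore] -/
theorem piE_single' {s : ℕ} (E : Fin s → Expo) (i : Fin s) : piE E (Finsupp.single i 1) = E i := by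
  rw [piE_eq_linearCombination, Finsupp.linearCombination_single, one_smul]

/-- `piE_zero'` (R3 toolkit). [folklore] -/
theorem piE_zero' {s : ℕ} (E : Fin s → Expo) : piE E 0 = 0 := by
  rw [piE_eq_linearCombination, map_zero]

/-- `piE_finset_sum` (R3 toolkit). [folklore] -/
theorem piE_finset_sum {s : ℕ} (E : Fin s → Expo) (g : Fin m → (Fin s →₀ ℕ)) :
    piE E (∑ j, g j) = ∑ j, piE E (g j) := by
  simp only [piE_eq_linearCombination, map_sum]

/-- A lifted support point of `∏(1 + U_j)` comes from a letter tuple of the family, with matching point and multiset. [folklore] -/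
theorem tuple_of_mem_support_prod (hu : ∀ j, coeff 0 (u j) = 0) (hv : ∀ j, coeff 0 (v j) = 0)
    (A : Fin m → Finset Expo) (c : Fin m → Fin (sE u v) → ℂ) (hc : ∀ j i, c j i ≠ 0 → enum u v i ∈ A j)
    (κ : Fin (sE u v) →₀ ℕ) (hκ : κ ∈ (∏ j, (1 + lin (c j))).support) :
    ∃ a ∈ tuples A, ∑ j, a j = piE (enum u v) κ ∧ msetT a = Finsupp.mapDomain (enum u v) κ := by
  classical
  obtain ⟨g, hg, -, hsum⟩ := exists_tuple_of_mem_support_prod c Finset.univ κ (by simpa using hκ)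
  refine ⟨fun j => piE (enum u v) (g j), ?_, ?_, ?_⟩
  · refine Fintype.mem_piFinset.2 fun j => ?_
    rcases hg j with h | ⟨i, hi, h⟩
    · rw [h, piE_zero']
      exact Finset.mem_insert_self _ _
    · rw [h, piE_single']
      exact Finset.mem_insert_of_mem (hc j i hi)
  · rw [← hsum, piE_finset_sum]
  · rw [← hsum, Finsupp.mapDomain_finsetSum]
    unfold msetT
    refine Finset.sum_congr rfl fun j _ => ?_
    show (if piE (enum u v) (g j) = 0 then 0 else Finsupp.single (piE (enum u v) (g j)) 1) =
      Finsupp.mapDomain (enum u v) (g j)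
    rcases hg j with h | ⟨i, hi, h⟩
    · rw [h, piE_zero', if_pos rfl, Finsupp.mapDomain_zero]
    · rw [h, piE_single', if_neg (enum_ne_zero u v hu hv i), Finsupp.mapDomain_single]

/-- **Family-level permutation type ⇒ the push-forward is injective on the lifted support.** [folklore] -/
theorem injOn_of_permType (hu : ∀ j, coeff 0 (u j) = 0) (hv : ∀ j, coeff 0 (v j) = 0)
    (A : Fin m → Finset Expo) (huA : ∀ j, (u j).support ⊆ A j) (hvA : ∀ j, (v j).support ⊆ A j)
    (hperm : PermType A) :
    Set.InjOn (piE (enum u v)) ↑(liftG (cU u v) (cV u v)).support := by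
  classical
  have hcU : ∀ j i, cU u v j i ≠ 0 → enum u v i ∈ A j := fun j i h => huA j (mem_support_iff.mpr h)
  have hcV : ∀ j i, cV u v j i ≠ 0 → enum u v i ∈ A j := fun j i h => hvA j (mem_support_iff.mpr h)
  have key : ∀ κ ∈ (liftG (cU u v) (cV u v)).support,
      ∃ a ∈ tuples A, ∑ j, a j = piE (enum u v) κ ∧ msetT a = Finsupp.mapDomain (enum u v) κ := by
    intro κ hκ
    unfold liftG at hκ
    rcases Finset.mem_union.1 (support_sub _ _ _ hκ) with h | h
    · exact tuple_of_mem_support_prod u v hu hv A (cU u v) hcU κ h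
    · exact tuple_of_mem_support_prod u v hu hv A (cV u v) hcV κ h
  intro κ hκ κ' hκ' hπ
  obtain ⟨a, ha, haS, haM⟩ := key κ hκ
  obtain ⟨b, hb, hbS, hbM⟩ := key κ' hκ'
  have hab : msetT a = msetT b := hperm a ha b hb (by rw [haS, hbS]; exact hπ)
  rw [haM, hbM] at hab
  exact Finsupp.mapDomain_injective (enum_injective u v) hab

/-- **R3♯ (family-level permutation-type law).** If every additive coincidence of the letter family
`A_j = supp u_j ∪ supp v_j` is of permutation type, then GLOBALLY `#visible ≤ 2^{13m}(#T+2)^2`. [folklore] -/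
theorem permTypeLaw_proof :
    ∀ (m : ℕ) (u v : Fin m → MvPolynomial (Fin 2) ℂ), (∀ j, coeff 0 (u j) = 0) → (∀ j, coeff 0 (v j) = 0) →
    PermType (fun j => (u j).support ∪ (v j).support) →
    ∀ S : Finset Expo, (∀ l ∈ S, ∃ ξ : Fin 2 → ℝ, ValidWeight u v ξ ∧ IsStrictTop ξ ↑(tailDiff u v).support l) →
      S.card ≤ 2 ^ (13 * m) * ((tailSupport u v).card + 2) ^ 2 :=
  fun m u v hu0 hv0 hperm S hS =>
    count_of_injOn m u v hu0 hv0
      (injOn_of_permType u v hu0 hv0 _ (fun _ => Finset.subset_union_left) (fun _ => Finset.subset_union_right) hperm) S hS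

/-- Dissociated families (`Σ` injective on letter tuples, p603804's hypothesis) are of permutation type. [folklore] -/
theorem permType_of_injOn (A : Fin m → Finset Expo) (h : Set.InjOn (fun a : Fin m → Expo => ∑ j, a j) ↑(tuples A)) :
    PermType A := by
  intro a ha b hb hab
  have : a = b := h (Finset.mem_coe.2 ha) (Finset.mem_coe.2 hb) hab
  rw [this]

end PermType


/-- `T ⊆ ℕ²` is a `B_h`-set in the strong sense: multisets of at most `h` letters of `T` are determined by their sums (verbatim the
line's `IsBm`). [folklore] -/
def IsBm (h : ℕ) (T : Finset (Fin 2 →₀ ℕ)) : Prop :=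
  ∀ ν ν' : (Fin 2 →₀ ℕ) →₀ ℕ, ν.support ⊆ T → ν'.support ⊆ T →
    (ν.sum fun _ k => k) ≤ h → (ν'.sum fun _ k => k) ≤ h →
    (ν.sum fun e k => k • e) = (ν'.sum fun e k => k • e) → ν = ν'

section Statement
open Summit.ValiantsHypothesis.ValiantsHypothesis.Theorems.NewtonUnitEquations.TwoProducts.FormalLogLinearisation
open Summit.ValiantsHypothesis.ValiantsHypothesis.Theorems.NewtonUnitEquations.TwoProducts.PlanarCell

/-- **Permutation-type law (rung R3 of the line `relation_ladder`, verbatim its `PermutationTypeLaw`).** For constant-free tails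
`u, v : Fin m → ℂ[x,y]` whose tail alphabet `T = tailSupport u v` is a `B_m`-set, the number of exponents that are the strict
`ξ`-top of `supp(∏(1+u_j) − ∏(1+v_j))` for some valid weight `ξ` is at most `2^{13m} (#T+2)^2`. [folklore] -/
theorem visibleCount_of_isBm :
    ∀ (m : ℕ) (u v : Fin m → MvPolynomial (Fin 2) ℂ), (∀ j, coeff 0 (u j) = 0) → (∀ j, coeff 0 (v j) = 0) →
    IsBm m (tailSupport u v) →
    ∀ S : Finset Expo, (∀ l ∈ S, ∃ ξ : Fin 2 → ℝ, ValidWeight u v ξ ∧ IsStrictTop ξ ↑(tailDiff u v).support l) →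
      S.card ≤ 2 ^ (13 * m) * ((tailSupport u v).card + 2) ^ 2 :=
  fun m u v hu hv hBm S hS => permutationTypeLaw_proof m u v hu hv hBm S hS

/-- **Family-level permutation-type law (rung R3♯ of the line `relation_ladder`, verbatim its `PermTypeLaw`).** If every
additive coincidence of the letter family `A_j = supp u_j ∪ supp v_j` — two `0`-filled letter tuples with the same sum — is of
permutation type (`PermType`: equal letter multisets), then the number of exponents that are the strict `ξ`-top of
`supp(∏(1+u_j) − ∏(1+v_j))` for some valid weight `ξ` is at most `2^{13m} (#T+2)^2`.  Contains the dissociated regime of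
`planarCell_dissociated_linear` (p603804; `permType_of_injOn`) as a GLOBAL bound, and `visibleCount_of_isBm`. [folklore] -/
theorem visibleCount_of_permType :
    ∀ (m : ℕ) (u v : Fin m → MvPolynomial (Fin 2) ℂ), (∀ j, coeff 0 (u j) = 0) → (∀ j, coeff 0 (v j) = 0) →
    PermType (fun j => (u j).support ∪ (v j).support) →
    ∀ S : Finset Expo, (∀ l ∈ S, ∃ ξ : Fin 2 → ℝ, ValidWeight u v ξ ∧ IsStrictTop ξ ↑(tailDiff u v).support l) →
      S.card ≤ 2 ^ (13 * m) * ((tailSupport u v).card + 2) ^ 2 :=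
  permTypeLaw_proof

/-- `PermType` is antitone in the letter family. [folklore] -/
theorem permType_mono {m : ℕ} {A A' : Fin m → Finset Expo} (h : ∀ j, A' j ⊆ A j) (hP : PermType A) : PermType A' := by
  intro a ha b hb hab
  have hsub : tuples A' ⊆ tuples A := fun c hc =>
    Fintype.mem_piFinset.2 fun j => Finset.insert_subset_insert _ (h j) (Fintype.mem_piFinset.1 hc j)
  exact hP a (hsub ha) b (hsub hb) hab

/-- Merging a singleton block does not enlarge the letter family. [folklore] -/
theorem mergeA_singleton_subset {m : ℕ} (A : Fin m → Finset Expo) (j₀ j : Fin m) : mergeA A {j₀} j₀ j ⊆ A j := by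
  classical
  unfold mergeA
  split_ifs with h1 h2
  · subst h1
    intro e he
    obtain ⟨hne, hmem⟩ := Finset.mem_erase.1 he
    unfold blockSet at hmem
    obtain ⟨a, ha, hsum⟩ := Finset.mem_image.1 hmem
    rw [Finset.sum_singleton] at hsum
    have haj : a j ∈ insert (0 : Expo) (A j) := Fintype.mem_piFinset.1 ha j
    rw [hsum] at haj
    rcases Finset.mem_insert.1 haj with h0 | h
    · exact absurd h0 hne
    · exact h
  · exact absurd (Finset.mem_singleton.1 h2) h1
  · exact fun e he => he

/-- A confined block has a permutation-type merged family. [folklore] -/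
theorem permType_mergeA_of_confined {m : ℕ} (A : Fin m → Finset Expo) (J : Finset (Fin m)) (j₀ : Fin m) (hj₀ : j₀ ∈ J)
    (hconf : Confined A J) : PermType (mergeA A J j₀) :=
  permType_of_injOn _ (injOn_mergeA A J j₀ hj₀ hconf)

/-- `Confined A ∅` (dissociation) gives permutation type. [folklore] -/
theorem permType_of_confined_empty {m : ℕ} (A : Fin m → Finset Expo) (hconf : Confined A ∅) : PermType A := by
  refine permType_of_injOn A fun a ha b hb hab => ?_
  exact funext fun j => hconf a (Finset.mem_coe.1 ha) b (Finset.mem_coe.1 hb) hab j (Finset.notMem_empty j)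

/-- **Merged permutation-type law (rung R5 of the line `relation_ladder`, verbatim its `MergedPermTypeLaw`).**  For any block
`J ∋ j₀` whose sumset has at most `M` points (`BlockSmall`), if the MERGED letter family `mergeA A J j₀` is of permutation type,
then the number of visible exponents of `∏(1+u_j) − ∏(1+v_j)` is at most `2^{13m}(M + m s + 2)^2`.  `J = {j₀}` is
`visibleCount_of_permType`; a confined `J` gives `visibleCount_of_confined_blockSmall` (the regime of `planarCell_blockLaw`,
p608838, globally and with exponent `2`). [folklore] -/
theorem visibleCount_of_mergedPermType {m : ℕ} (s M : ℕ) (u v : Fin m → MvPolynomial (Fin 2) ℂ)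
    (A : Fin m → Finset Expo) (J : Finset (Fin m)) (j₀ : Fin m) (hj₀ : j₀ ∈ J) (hA0 : ∀ j, (0 : Expo) ∉ A j)
    (hAs : ∀ j, (A j).card ≤ s) (hu : ∀ j, (u j).support ⊆ A j) (hv : ∀ j, (v j).support ⊆ A j)
    (hB : BlockSmall A J M) (hperm : PermType (mergeA A J j₀)) (S : Finset Expo)
    (hS : ∀ l ∈ S, ∃ ξ : Fin 2 → ℝ, ValidWeight u v ξ ∧ IsStrictTop ξ ↑(tailDiff u v).support l) :
    S.card ≤ 2 ^ (13 * m) * (M + m * s + 2) ^ 2 := by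
  have hu0 : ∀ j, coeff 0 (u j) = 0 := fun j => notMem_support_iff.1 fun h => hA0 j (hu j h)
  have hv0 : ∀ j, coeff 0 (v j) = 0 := fun j => notMem_support_iff.1 fun h => hA0 j (hv j h)
  have hu0' : ∀ j, coeff 0 (merge u J j₀ j) = 0 := coeff_zero_merge u J j₀ hu0
  have hv0' : ∀ j, coeff 0 (merge v J j₀ j) = 0 := coeff_zero_merge v J j₀ hv0
  have hperm' : PermType (fun j => (merge u J j₀ j).support ∪ (merge v J j₀ j).support) :=
    permType_mono (fun j => Finset.union_subset (support_merge_subset u A J j₀ hj₀ hA0 hu j)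
      (support_merge_subset v A J j₀ hj₀ hA0 hv j)) hperm
  have hS' : ∀ l ∈ S, ∃ ξ : Fin 2 → ℝ, ValidWeight (merge u J j₀) (merge v J j₀) ξ ∧
      IsStrictTop ξ ↑(tailDiff (merge u J j₀) (merge v J j₀)).support l := fun l hl => by
    obtain ⟨ξ, hval, htop⟩ := hS l hl
    exact ⟨ξ, validWeight_merge u v J j₀ hj₀ hu0 hv0 hval, by rw [tailDiff_merge u v J j₀ hj₀]; exact htop⟩
  have key := permTypeLaw_proof m (merge u J j₀) (merge v J j₀) hu0' hv0' hperm' S hS'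
  have hT := card_tailSupport_merge_le u v A J j₀ hj₀ hA0 hu hv M s hAs hB
  calc S.card ≤ 2 ^ (13 * m) * ((tailSupport (merge u J j₀) (merge v J j₀)).card + 2) ^ 2 := key
    _ ≤ 2 ^ (13 * m) * (M + m * s + 2) ^ 2 := Nat.mul_le_mul_left _ (Nat.pow_le_pow_left (by omega) 2)

/-- Confined block with small sumset (the regime of `planarCell_blockLaw`), GLOBAL count with exponent `2`. [folklore] -/
theorem visibleCount_of_confined_blockSmall {m : ℕ} (s M : ℕ) (u v : Fin m → MvPolynomial (Fin 2) ℂ)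
    (A : Fin m → Finset Expo) (J : Finset (Fin m)) (j₀ : Fin m) (hj₀ : j₀ ∈ J) (hA0 : ∀ j, (0 : Expo) ∉ A j)
    (hAs : ∀ j, (A j).card ≤ s) (hu : ∀ j, (u j).support ⊆ A j) (hv : ∀ j, (v j).support ⊆ A j)
    (hconf : Confined A J) (hB : BlockSmall A J M) (S : Finset Expo)
    (hS : ∀ l ∈ S, ∃ ξ : Fin 2 → ℝ, ValidWeight u v ξ ∧ IsStrictTop ξ ↑(tailDiff u v).support l) :
    S.card ≤ 2 ^ (13 * m) * (M + m * s + 2) ^ 2 :=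
  visibleCount_of_mergedPermType s M u v A J j₀ hj₀ hA0 hAs hu hv hB (permType_mergeA_of_confined A J j₀ hj₀ hconf) S hS

end Statement

end Summit.ValiantsHypothesis.ValiantsHypothesis.Theorems.NewtonUnitEquations.TwoProducts.PermutationType

end
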